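import Literature.Probability.LatticeModels.FieldCurrentsR2Bound
import HarnessLib

/-!
# The single-spin cluster expansion of Aizenman–Fernández (Prop. 3.4) for general couplings, and two consequences

Topic `Probability/LatticeModels`, namespace `Literature.Probability.LatticeModels`. Sequel of
`FieldCurrentsTreeBound` / `FieldCurrentsR2Bound` (pair sums on the ghost graph with general
couplings `θ ≥ 0`, conditioning on the cluster complement `𝒮_b`, the restricted systems
`θ_T = θ𝟙_{ℰ_T}`, the two-pair identity (5.1)).

Aizenman–Fernández 1986, Prop. 3.4 ((3.14), p. 412): for `x ∈ Λ`, `A ⊆ Λ`,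

  `⟨σ_x; σ_A⟩ = ∑_{A₁ ⊆ A, |A₁| odd} Z⁻² ∑_{∂n₁ = {x}ΔA₁, ∂n₂ = ∅} w w 𝟙[x ↔ a ∀a ∈ A₁] 𝟙[x ↮ h] ⟨σ_{AΔA₁}⟩_{C^c(x)}`,

obtained from `⟨σ_x;σ_A⟩ Z² = ∑_{∂n₁ = {x}ΔA, ∂n₂ = ∅} w w 𝟙[x ↮ h]` (switching) by conditioning
on the cluster of `x`. This file proves, for the `θ`-system:

* `thetaCorr_symmDiff_sub_mul_eq` — **(3.15) for a general set `A`**: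
  `⟨σ_{{x}ΔA}⟩_θ - ⟨σ_x⟩_θ⟨σ_A⟩_θ = Z⁻² ∑_{({x}ΔA)*, ∅} w w 𝟙[x ↮ g]`;
* the expansion over the values `S ∋ g` of `𝒮_x` (`currentPairSum_notConn_single_eq_sum`), the
  per-`S` factorisation `∑_{Y,∅} w w 𝟙[𝒮_x = S] · Z_S(∅) = Z_S(Y ∩ S) · ∑_{Y∖S,∅} w w 𝟙[𝒮_x = S]`
  (`currentPairSum_clusterCompl_single_mul_eq`) and the parity of the sources in the cluster of
  `x` (`currentPairSum_clusterCompl_eq_zero_of_odd`);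
* **the (3.16)-inequality** `⟨σ_z;σ_kσ_l⟩_θ ≤ ⟨σ_l⟩_θ⟨σ_z;σ_k⟩_θ + ⟨σ_k⟩_θ⟨σ_z;σ_l⟩_θ` for
  distinct `z, k, l` (`thetaTrunc_three_le`; Aizenman–Fernández's (5.8), first step, from (3.16)
  and `⟨σ⟩_{C^c} ≤ ⟨σ⟩`);
* **the bound on the triple terms `Δ₂`** ((5.10)):
  `∑_{({x}Δ{u}Δ{v}Δ{k})*,∅} w w 𝟙[x ↮ g] 𝟙[x ↔ u] 𝟙[x ↔ v] 𝟙[x ↔ k] ≤ ⟨σ_vσ_k⟩_{θ,h=0} ∑_{({x}Δ{u})*,∅} w w 𝟙[x ↮ g]`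
  (`currentPairSum_four_conn_le`: switch the pair `{v,k}` out, condition on the cluster of the
  ghost (5.1), `⟨σ_vσ_k⟩_{C^c(h)} ≤ ⟨σ_vσ_k⟩_{h=0}`, and (5.3)).

## References

* M. Aizenman, R. Fernández, J. Stat. Phys. **44** (1986) 393–454, §3.4 Prop. 3.4 (3.13)–(3.16),
  pp. 412–413; §5.1, proof of Prop. 5.2, (5.7)–(5.10), pp. 426–427 [AizenmanFernandezJSP1986]
  (held: author copy `paper:url-b8cebc3f44bb`, PDF pp. 20–21, 34–35).
* H. Duminil-Copin, V. Tassion, CMP **343** (2016) 725, §2.3 and proof of Lemma 2.6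
  (arXiv:1502.03050 numbering) [DuminilCopinTassionCMP2016].
-/

noncomputable section

open Finset MeasureTheory
open scoped symmDiff ENNReal

namespace Literature.Probability.LatticeModels

variable {V : Type*} [DecidableEq V]

section SingleSpin

variable {G : SimpleGraph V} [G.LocallyFinite] {Λ : Finset V}

local notation "Gg" => ghostGraph G Λ
local notation "Λg" => Finset.insertNone Λ
local notation "Eg" => edgesIn (ghostGraph G Λ) (Finset.insertNone Λ)
local notation "Zg[" θ ", " X "]" =>
  gcurrentZ (ghostGraph G Λ) (Finset.insertNone Λ) θ (edgesIn (ghostGraph G Λ) (Finset.insertNone Λ)) X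
local notation "Conn[" m ", " u ", " v "]" =>
  CConn (ghostGraph G Λ) (Finset.insertNone Λ) m (edgesIn (ghostGraph G Λ) (Finset.insertNone Λ)) u v
local notation "∂g" => csources (ghostGraph G Λ) (Finset.insertNone Λ)
local notation "𝒮[" m ", " b "]" => clusterCompl (ghostGraph G Λ) (Finset.insertNone Λ) m b

/-! ### The source sets `A*` -/

omit [DecidableEq V] in
/-- `A*` has even cardinality. [folklore] -/
theorem even_card_starSet [DecidableEq V] (A : Finset V) : Even #(starSet A) := by
  unfold starSet
  split_ifs with h
  · rwa [card_map]
  · rw [Finset.card_insertNone]; exact Nat.even_add_one.2 h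

/-- `eraseNone` commutes with symmetric differences. [folklore] -/
theorem eraseNone_symmDiff (P Q : Finset (Option V)) :
    Finset.eraseNone (P ∆ Q) = Finset.eraseNone P ∆ Finset.eraseNone Q := by
  ext a
  simp only [Finset.mem_eraseNone, mem_symmDiff]

/-- **`({x} Δ A)* Δ {x, g} = A*`**: switching the pair `{x, g}` between the source sets. [folklore] -/
theorem starSet_symmDiff_singleton (x : V) (A : Finset V) :
    starSet ({x} ∆ A) ∆ ({some x} ∆ {none}) = starSet A := by
  have hpair : ({some x} ∆ {none} : Finset (Option V)) = {some x, none} := by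
    ext v; simp only [mem_symmDiff, mem_singleton, mem_insert]
    constructor
    · rintro (⟨h, -⟩ | ⟨h, -⟩) <;> simp [h]
    · rintro (rfl | rfl)
      · exact Or.inl ⟨rfl, Option.some_ne_none x⟩
      · exact Or.inr ⟨rfl, fun h => Option.some_ne_none x h.symm⟩
  have heven : Even #(starSet ({x} ∆ A) ∆ ({some x} ∆ {none} : Finset (Option V))) := by
    rw [even_card_symmDiff_iff]
    refine ⟨fun _ => ?_, fun _ => even_card_starSet _⟩
    rw [hpair, card_pair (Option.some_ne_none x)]
    exact even_two
  refine (eraseNone_eq_iff_eq_starSet heven A).1 ?_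
  rw [eraseNone_symmDiff, eraseNone_starSet, eraseNone_symmDiff]
  have h1 : Finset.eraseNone ({some x} : Finset (Option V)) = {x} := by ext a; simp
  have h2 : Finset.eraseNone ({none} : Finset (Option V)) = ∅ := by ext a; simp
  rw [h1, h2]
  have h3 : ({x} ∆ ∅ : Finset V) = {x} := symmDiff_bot _
  rw [h3, symmDiff_comm {x} A, symmDiff_symmDiff_cancel_right]

/-! ### (3.15) for a general set of spins -/

/-- **`Z({x}*) Z(A*) = ∑_{({x}ΔA)*, ∅} w w 𝟙[x ↔ g]`** (switching the pair `{x, g}`). [cite: AizenmanFernandezJSP1986, §3.4, proof of Prop. 3.4, p. 413 ("we use the switching lemma (3.9) to obtain the same source distribution")] -/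
theorem gcurrentZ_single_mul_starSet {θ : Sym2 (Option V) → ℝ} (hθ : ∀ e, 0 ≤ θ e) (x : V) (A : Finset V) :
    Zg[θ, starSet {x}] * Zg[θ, starSet A] =
      currentPairSum G Λ θ (starSet ({x} ∆ A)) ∅ (fun m => ind (Conn[m, some x, none])) := by
  rw [mul_comm, ← currentPairSum_one, starSet_singleton]
  have h := currentPairSum_switching (G := G) (Λ := Λ) hθ (starSet ({x} ∆ A)) (some x) none (fun _ => 1)
  rw [starSet_symmDiff_singleton] at h
  rw [h]
  exact currentPairSum_congr fun _ _ _ _ => by rw [one_mul]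

/-- **Aizenman–Fernández (3.15) for a general set `A`** (the first display of the proof of
Prop. 3.4): for `θ ≥ 0`, `x ∈ Λ`, `A ⊆ Λ`,
`⟨σ_{{x}ΔA}⟩_θ - ⟨σ_x⟩_θ ⟨σ_A⟩_θ = Z⁻² ∑_{∂n₁ = ({x}ΔA)*, ∂n₂ = ∅} w w 𝟙[x ↮ g]`. [cite: AizenmanFernandezJSP1986, §3.4, proof of Prop. 3.4, pp. 412–413] -/
theorem thetaCorr_symmDiff_sub_mul_eq {θ : Sym2 (Option V) → ℝ} (hθ : ∀ e, 0 ≤ θ e) {x : V} (hx : x ∈ Λ)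
    {A : Finset V} (hA : A ⊆ Λ) :
    thetaCorr G Λ θ ({x} ∆ A) - thetaCorr G Λ θ {x} * thetaCorr G Λ θ A =
      (currentPairSum G Λ θ (starSet ({x} ∆ A)) ∅ (fun m => ind (¬Conn[m, some x, none]))).toReal /
        (Zg[θ, ∅]).toReal ^ 2 := by
  have hxA : ({x} ∆ A : Finset V) ⊆ Λ := symmDiff_le_sup.trans (sup_le (singleton_subset_iff.2 hx) hA)
  have hZpos : 0 < (Zg[θ, ∅]).toReal := toReal_gcurrentZ_ghost_empty_pos subset_rfl hθ subset_rfl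
  rw [thetaCorr_eq_gcurrentZ_div hθ hxA, thetaCorr_eq_gcurrentZ_div hθ (singleton_subset_iff.2 hx),
    thetaCorr_eq_gcurrentZ_div hθ hA]
  -- `Z(({x}ΔA)*) Z(∅) = ∑ 1 = ∑ 𝟙[x ↔ g] + ∑ 𝟙[x ↮ g]`
  have hsplit : Zg[θ, starSet ({x} ∆ A)] * Zg[θ, ∅] =
      Zg[θ, starSet {x}] * Zg[θ, starSet A] +
        currentPairSum G Λ θ (starSet ({x} ∆ A)) ∅ (fun m => ind (¬Conn[m, some x, none])) := by
    rw [gcurrentZ_single_mul_starSet hθ, ← currentPairSum_one, ← currentPairSum_add]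
    refine currentPairSum_congr fun n₁ n₂ _ _ => ?_
    by_cases h : Conn[n₁ + n₂, some x, none]
    · rw [ind_of_true h, ind_of_false (not_not.2 h), add_zero]
    · rw [ind_of_false h, ind_of_true h, zero_add]
  have hreal := congrArg ENNReal.toReal hsplit
  rw [ENNReal.toReal_mul, ENNReal.toReal_add (ENNReal.mul_ne_top (gcurrentZ_ne_top hθ subset_rfl _)
      (gcurrentZ_ne_top hθ subset_rfl _)) (currentPairSum_ne_top hθ _ _ fun _ => ind_le_one _),
    ENNReal.toReal_mul] at hreal
  field_simp
  linear_combination hreal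

/-! ### Expansion over the cluster of `x` -/

/-- **Decomposition over the values of `𝒮_x` containing the ghost**:
`∑ w w 𝟙[x ↮ g] F = ∑_{S ∋ g} ∑ w w 𝟙[𝒮_x = S] F`. [cite: AizenmanFernandezJSP1986, §3.4, Prop. 3.4, eq. (3.14), p. 412] -/
theorem currentPairSum_notConn_single_eq_sum (θ : Sym2 (Option V) → ℝ) (x : V) (X Y : Finset (Option V))
    (F : (Eg → ℕ) → ℝ≥0∞) :
    currentPairSum G Λ θ X Y (fun m => ind (¬Conn[m, some x, none]) * F m) =
      ∑ S ∈ (Λg).powerset.filter (fun S => (none : Option V) ∈ S),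
        currentPairSum G Λ θ X Y (fun m => ind (𝒮[m, some x] = S) * F m) := by
  rw [currentPairSum_eq_sum_clusterCompl' θ (some x), sum_filter]
  refine sum_congr rfl fun S _ => ?_
  by_cases hn : (none : Option V) ∈ S
  · rw [if_pos hn]
    refine currentPairSum_congr fun n₁ n₂ _ _ => ?_
    by_cases hS : 𝒮[n₁ + n₂, some x] = S
    · rw [ind_of_true hS, one_mul, one_mul, ind_of_true (none_mem_clusterCompl_iff.1 (hS ▸ hn)), one_mul]
    · rw [ind_of_false hS, zero_mul, zero_mul]
  · rw [if_neg hn]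
    have h0 : currentPairSum G Λ θ X Y (fun _ => 0) = 0 := by unfold currentPairSum; simp
    rw [← h0]
    refine currentPairSum_congr fun n₁ n₂ _ _ => ?_
    by_cases hS : 𝒮[n₁ + n₂, some x] = S
    · have : Conn[n₁ + n₂, some x, none] := by
        by_contra hc
        exact hn (hS ▸ none_mem_clusterCompl_iff.2 hc)
      rw [ind_of_true hS, one_mul, ind_of_false (not_not.2 this), zero_mul]
    · rw [ind_of_false hS, zero_mul]

/-- **Factorisation of a single pair sum on `{𝒮_x = S}`**:
`∑_{Y,∅} w w 𝟙[𝒮_x = S] · Z_S(∅) = Z_S(Y ∩ S) · ∑_{Y∖S, ∅} w w 𝟙[𝒮_x = S]` (the sources inside `S`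
are carried by the inner factor, Aizenman–Fernández's `⟨σ_{AΔA₁}⟩_{C^c(x)}`). [cite: AizenmanFernandezJSP1986, §3.4, Prop. 3.4, eqs. (3.13)–(3.14), p. 412] -/
theorem currentPairSum_clusterCompl_single_mul_eq (θ : Sym2 (Option V) → ℝ) {S : Finset (Option V)} (hS : S ⊆ Λg)
    {x : V} (hxS : (some x : Option V) ∈ Λg \ S) (Y : Finset (Option V)) :
    currentPairSum G Λ θ Y ∅ (fun m => ind (𝒮[m, some x] = S)) * gcurrentZ Gg Λg θ (edgesIn Gg S) ∅ =
      gcurrentZ Gg Λg θ (edgesIn Gg S) (Y.filter (· ∈ S)) *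
        currentPairSum G Λ θ (Y.filter (· ∉ S)) ∅ (fun m => ind (𝒮[m, some x] = S)) := by
  rw [currentPairSum_clusterCompl_eq θ hS hxS, currentPairSum_clusterCompl_eq θ hS hxS]
  have h1 : (Y.filter (· ∉ S)).filter (· ∈ S) = ∅ := filter_false_of_mem fun v hv => (mem_filter.1 hv).2
  have h2 : (Y.filter (· ∉ S)).filter (· ∉ S) = Y.filter (· ∉ S) := filter_true_of_mem fun v hv => (mem_filter.1 hv).2
  rw [h1, h2]
  simp only [filter_empty]
  ring

/-- **Parity of the sources in the cluster of `x`**: on `{𝒮_x = S}` every source outside `S`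
is connected to `x`, so their number is even; if `#(Y ∖ S)` is odd the pair sum vanishes. [cite: AizenmanFernandezJSP1986, §3.4, proof of Prop. 3.4 ("The condition n₁+n₂ : x ↮ h implies that |A₁| is odd"), p. 413] -/
theorem currentPairSum_clusterCompl_eq_zero_of_odd (θ : Sym2 (Option V) → ℝ) {S : Finset (Option V)} {x : V}
    {Y : Finset (Option V)} (hY : Y ⊆ Λg) (hodd : Odd #(Y.filter (· ∉ S))) (F : (Eg → ℕ) → ℝ≥0∞) :
    currentPairSum G Λ θ Y ∅ (fun m => ind (𝒮[m, some x] = S) * F m) = 0 := by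
  have h0 : currentPairSum G Λ θ Y ∅ (fun _ => 0) = 0 := by unfold currentPairSum; simp
  rw [← h0]
  classical
  refine currentPairSum_congr fun n₁ n₂ h1 _ => ?_
  by_cases hS : 𝒮[n₁ + n₂, some x] = S
  · exfalso
    have heven := even_card_csources_filter_cconn (G := Gg) (Λ := Λg) (n := n₁) (m := n₁ + n₂)
      (fun e => Nat.le_add_right _ _) (some x)
    rw [h1] at heven
    have hfilt : Y.filter (fun v => Conn[n₁ + n₂, some x, v]) = Y.filter (· ∉ S) := by
      refine filter_congr fun v hv => ?_
      rw [← hS, mem_clusterCompl]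
      exact ⟨fun h h' => h'.2 h, fun h => by by_contra hc; exact h ⟨hY hv, hc⟩⟩
    rw [hfilt] at heven
    exact (Nat.not_even_iff_odd.2 hodd) heven
  · rw [ind_of_false hS, zero_mul]

/-- **The inner factor is a correlation of the restricted system**: for `B ⊆ Λ` with `B* ⊆ S`,
`Z_S(B*)/Z_S(∅) = ⟨σ_B⟩_{θ_S}`. [cite: AizenmanFernandezJSP1986, §3.3, Lemma 3.2, eq. (3.10)] -/
theorem toReal_gcurrentZ_inner_div_eq {θ : Sym2 (Option V) → ℝ} (hθ : ∀ e, 0 ≤ θ e) {S : Finset (Option V)}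
    (hS : S ⊆ Λg) {B : Finset V} (hB : B ⊆ Λ) :
    (gcurrentZ Gg Λg θ (edgesIn Gg S) (starSet B)).toReal / (gcurrentZ Gg Λg θ (edgesIn Gg S) ∅).toReal =
      thetaCorr G Λ (cplOff θ (Eg \ edgesIn Gg S)) B :=
  (thetaCorr_cplOff_eq_gcurrentZ_div (G := G) (Λ := Λ) hθ hS hB).symm

/-- **The per-`S` term of the single-spin expansion, in real numbers**: for `S ⊆ Λ⁺ ∖ {x}`,
`B ⊆ Λ` with `B* ⊆ S` and `Y'` disjoint from `S`,
`∑_{B* ∪ Y', ∅} w w 𝟙[𝒮_x = S] = ⟨σ_B⟩_{θ_S} · ∑_{Y',∅} w w 𝟙[𝒮_x = S]` whenever `B* ∪ Y'` is the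
given source set `Y` (`Y ∩ S = B*`, `Y ∖ S = Y'`). [cite: AizenmanFernandezJSP1986, §3.4, Prop. 3.4, eq. (3.14), p. 412] -/
theorem toReal_currentPairSum_clusterCompl_single_eq {θ : Sym2 (Option V) → ℝ} (hθ : ∀ e, 0 ≤ θ e)
    {S : Finset (Option V)} (hS : S ⊆ Λg) {x : V} (hxS : (some x : Option V) ∈ Λg \ S) {Y : Finset (Option V)}
    {B : Finset V} (hB : B ⊆ Λ) (hYB : Y.filter (· ∈ S) = starSet B) :
    (currentPairSum G Λ θ Y ∅ (fun m => ind (𝒮[m, some x] = S))).toReal =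
      thetaCorr G Λ (cplOff θ (Eg \ edgesIn Gg S)) B *
        (currentPairSum G Λ θ (Y.filter (· ∉ S)) ∅ (fun m => ind (𝒮[m, some x] = S))).toReal := by
  have h := congrArg ENNReal.toReal (currentPairSum_clusterCompl_single_mul_eq (G := G) (Λ := Λ) θ hS hxS Y)
  rw [ENNReal.toReal_mul, ENNReal.toReal_mul, hYB] at h
  rw [← toReal_gcurrentZ_inner_div_eq hθ hS hB]
  have hpos := toReal_gcurrentZ_inner_empty_pos (G := G) (Λ := Λ) hθ hS
  field_simp
  linear_combination h

/-! ### The (3.16)-inequality for three distinct spins -/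

/-- `{z} Δ ({k} Δ {l}) = {z, k, l}` for distinct `z, k, l`. [folklore] -/
theorem symmDiff_three_eq {z k l : V} (hzk : z ≠ k) (hzl : z ≠ l) (hkl : k ≠ l) :
    ({z} ∆ ({k} ∆ {l}) : Finset V) = {z, k, l} := by
  ext a
  simp only [mem_symmDiff, mem_singleton, mem_insert]
  constructor
  · rintro (⟨rfl, -⟩ | ⟨⟨rfl, -⟩ | ⟨rfl, -⟩, -⟩) <;> simp
  · rintro (rfl | rfl | rfl)
    · exact Or.inl ⟨rfl, fun h => by rcases h with ⟨h, -⟩ | ⟨h, -⟩ <;> [exact hzk h; exact hzl h]⟩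
    · exact Or.inr ⟨Or.inl ⟨rfl, hkl⟩, fun h => hzk h.symm⟩
    · exact Or.inr ⟨Or.inr ⟨rfl, fun h => hkl h.symm⟩, fun h => hzl h.symm⟩

/-- `({z,k,l})* = {z, k, l, g}` for distinct `z, k, l`. [folklore] -/
theorem starSet_three_eq {z k l : V} (hzk : z ≠ k) (hzl : z ≠ l) (hkl : k ≠ l) :
    starSet ({z} ∆ ({k} ∆ {l})) = ({some z, some k, some l, none} : Finset (Option V)) := by
  rw [symmDiff_three_eq hzk hzl hkl, starSet]
  have hcard : #({z, k, l} : Finset V) = 3 := by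
    rw [card_insert_of_notMem (by simp [hzk, hzl]), card_pair hkl]
  rw [if_neg (by rw [hcard]; decide)]
  ext v
  cases v with
  | none => simp [Finset.mem_insertNone]
  | some a => simp [Finset.mem_insertNone]

/-- **Aizenman–Fernández (3.16) as an inequality, for general couplings**: for `θ ≥ 0` and
distinct `z, k, l ∈ Λ`,
`⟨σ_z; σ_kσ_l⟩_θ ≤ ⟨σ_l⟩_θ ⟨σ_z;σ_k⟩_θ + ⟨σ_k⟩_θ ⟨σ_z;σ_l⟩_θ`
(expand `Z²⟨σ_z;σ_kσ_l⟩ = ∑_{({z,k,l})*,∅} w w 𝟙[z ↮ g]` over the cluster of `z`: by parity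
exactly one of `k, l` lies in the cluster; the other contributes `⟨σ⟩_{C^c(z)} ≤ ⟨σ⟩`; resum with
(3.15)). This is the first step of (5.8). [cite: AizenmanFernandezJSP1986, §3.4, Cor. 3.5, eq. (3.16), p. 413, and §5.1, eq. (5.8), p. 426] -/
theorem thetaTrunc_three_le {θ : Sym2 (Option V) → ℝ} (hθ : ∀ e, 0 ≤ θ e) {z k l : V} (hz : z ∈ Λ) (hk : k ∈ Λ)
    (hl : l ∈ Λ) (hzk : z ≠ k) (hzl : z ≠ l) (hkl : k ≠ l) :
    thetaCorr G Λ θ ({z} ∆ ({k} ∆ {l})) - thetaCorr G Λ θ {z} * thetaCorr G Λ θ ({k} ∆ {l}) ≤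
      thetaCorr G Λ θ {l} * (thetaCorr G Λ θ ({z} ∆ {k}) - thetaCorr G Λ θ {z} * thetaCorr G Λ θ {k}) +
        thetaCorr G Λ θ {k} * (thetaCorr G Λ θ ({z} ∆ {l}) - thetaCorr G Λ θ {z} * thetaCorr G Λ θ {l}) := by
  classical
  set Z : ℝ := (Zg[θ, ∅]).toReal with hZ
  have hZpos : 0 < Z := toReal_gcurrentZ_ghost_empty_pos subset_rfl hθ subset_rfl
  have hkl' : ({k} ∆ {l} : Finset V) ⊆ Λ := symmDiff_le_sup.trans (sup_le (singleton_subset_iff.2 hk) (singleton_subset_iff.2 hl))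
  rw [thetaCorr_symmDiff_sub_mul_eq hθ hz hkl', thetaCorr_symmDiff_sub_mul_eq hθ hz (singleton_subset_iff.2 hk),
    thetaCorr_symmDiff_sub_mul_eq hθ hz (singleton_subset_iff.2 hl), starSet_three_eq hzk hzl hkl, starSet_pair,
    starSet_pair, ← hZ]
  set P' := (Λg).powerset.filter (fun S => (none : Option V) ∈ S) with hP'
  -- the three pair sums expanded over `S`
  set T : Finset (Option V) → ℝ := fun S =>
    (currentPairSum G Λ θ ({some z, some k, some l, none}) ∅ (fun m => ind (𝒮[m, some z] = S))).toReal with hT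
  set a : Finset (Option V) → ℝ := fun S =>
    (currentPairSum G Λ θ ({some z} ∆ {some k}) ∅ (fun m => ind (𝒮[m, some z] = S))).toReal with ha
  set b : Finset (Option V) → ℝ := fun S =>
    (currentPairSum G Λ θ ({some z} ∆ {some l}) ∅ (fun m => ind (𝒮[m, some z] = S))).toReal with hb
  have ha0 : ∀ S, 0 ≤ a S := fun S => ENNReal.toReal_nonneg
  have hb0 : ∀ S, 0 ≤ b S := fun S => ENNReal.toReal_nonneg
  have hexp : ∀ (Y : Finset (Option V)), (currentPairSum G Λ θ Y ∅ (fun m => ind (¬Conn[m, some z, none]))).toReal =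
      ∑ S ∈ P', (currentPairSum G Λ θ Y ∅ (fun m => ind (𝒮[m, some z] = S))).toReal := by
    intro Y
    have h1 : currentPairSum G Λ θ Y ∅ (fun m => ind (¬Conn[m, some z, none])) =
        currentPairSum G Λ θ Y ∅ (fun m => ind (¬Conn[m, some z, none]) * 1) :=
      currentPairSum_congr fun _ _ _ _ => (mul_one _).symm
    rw [h1, currentPairSum_notConn_single_eq_sum, ENNReal.toReal_sum (fun S _ =>
      currentPairSum_ne_top hθ _ _ fun _ => by rw [mul_one]; exact ind_le_one _)]
    exact sum_congr rfl fun S _ => by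
      rw [show (fun m => ind (𝒮[m, some z] = S) * 1) = (fun m : Eg → ℕ => ind (𝒮[m, some z] = S)) from
        funext fun _ => mul_one _]
  have hM_l : 0 ≤ thetaCorr G Λ θ {l} := thetaCorr_nonneg hθ (singleton_subset_iff.2 hl)
  have hM_k : 0 ≤ thetaCorr G Λ θ {k} := thetaCorr_nonneg hθ (singleton_subset_iff.2 hk)
  -- the termwise bound
  have hterm : ∀ S ∈ P', T S ≤ thetaCorr G Λ θ {l} * a S + thetaCorr G Λ θ {k} * b S := by
    intro S hS
    obtain ⟨hSΛ, hnS⟩ := mem_filter.1 hS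
    have hSΛ' : S ⊆ Λg := mem_powerset.1 hSΛ
    have hrest : 0 ≤ thetaCorr G Λ θ {l} * a S + thetaCorr G Λ θ {k} * b S :=
      add_nonneg (mul_nonneg hM_l (ha0 S)) (mul_nonneg hM_k (hb0 S))
    by_cases hzS : (some z : Option V) ∈ S
    · -- `z ∈ S`: impossible value of `𝒮_z`
      have : T S = 0 := by
        simp only [hT]
        rw [show (fun m => ind (𝒮[m, some z] = S)) = (fun m : Eg → ℕ => ind (𝒮[m, some z] = S) * 1) from
          funext fun _ => (mul_one _).symm, currentPairSum_clusterCompl_eq_zero_of_mem θ hzS]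
        simp
      rw [this]; exact hrest
    have hzS' : (some z : Option V) ∈ Λg \ S := mem_sdiff.2 ⟨Finset.some_mem_insertNone.2 hz, hzS⟩
    have hY : ({some z, some k, some l, none} : Finset (Option V)) ⊆ Λg := by
      intro v hv
      simp only [mem_insert, mem_singleton] at hv
      rcases hv with rfl | rfl | rfl | rfl
      · exact Finset.some_mem_insertNone.2 hz
      · exact Finset.some_mem_insertNone.2 hk
      · exact Finset.some_mem_insertNone.2 hl
      · exact Finset.mem_insertNone.2 (by simp)
    have hzk' : (some z : Option V) ≠ some k := fun h => hzk (Option.some_injective _ h)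
    have hzl' : (some z : Option V) ≠ some l := fun h => hzl (Option.some_injective _ h)
    have hkl'' : (some k : Option V) ≠ some l := fun h => hkl (Option.some_injective _ h)
    by_cases hkS : (some k : Option V) ∈ S <;> by_cases hlS : (some l : Option V) ∈ S
    · -- both in `S`: the sources outside are `{z}`, odd
      have hodd : Odd #(({some z, some k, some l, none} : Finset (Option V)).filter (· ∉ S)) := by
        have : ({some z, some k, some l, none} : Finset (Option V)).filter (· ∉ S) = {some z} := by
          ext v; simp only [mem_filter, mem_insert, mem_singleton]
          constructor
          · rintro ⟨h | h | h | h, hv⟩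
            · exact h
            · exact absurd (h ▸ hkS) hv
            · exact absurd (h ▸ hlS) hv
            · exact absurd (h ▸ hnS) hv
          · rintro rfl; exact ⟨Or.inl rfl, hzS⟩
        rw [this, card_singleton]; exact odd_one
      have : T S = 0 := by
        simp only [hT]
        rw [show (fun m => ind (𝒮[m, some z] = S)) = (fun m : Eg → ℕ => ind (𝒮[m, some z] = S) * 1) from
          funext fun _ => (mul_one _).symm, currentPairSum_clusterCompl_eq_zero_of_odd θ hY hodd]
        simp
      rw [this]; exact hrest
    · -- `k ∈ S`, `l ∉ S`: inner factor `⟨σ_k⟩_{θ_S}`, outer sources `{z, l}`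
      have hin : ({some z, some k, some l, none} : Finset (Option V)).filter (· ∈ S) = starSet {k} := by
        rw [starSet_singleton]
        ext v; simp only [mem_filter, mem_insert, mem_singleton, mem_symmDiff]
        constructor
        · rintro ⟨h | h | h | h, hv⟩
          · exact absurd (h ▸ hv) hzS
          · exact Or.inl ⟨h, fun h' => Option.some_ne_none k (h ▸ h')⟩
          · exact absurd (h ▸ hv) hlS
          · exact Or.inr ⟨h, fun h' => Option.some_ne_none k (h'.symm.trans h)⟩
        · rintro (⟨rfl, -⟩ | ⟨rfl, -⟩)
          · exact ⟨Or.inr (Or.inl rfl), hkS⟩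
          · exact ⟨Or.inr (Or.inr (Or.inr rfl)), hnS⟩
      have hout : ({some z, some k, some l, none} : Finset (Option V)).filter (· ∉ S) = {some z} ∆ {some l} := by
        ext v; simp only [mem_filter, mem_insert, mem_singleton, mem_symmDiff]
        constructor
        · rintro ⟨h | h | h | h, hv⟩
          · exact Or.inl ⟨h, fun h' => hzl' (h.symm.trans h')⟩
          · exact absurd (h ▸ hkS) hv
          · exact Or.inr ⟨h, fun h' => hzl' (h'.symm.trans h)⟩
          · exact absurd (h ▸ hnS) hv
        · rintro (⟨rfl, -⟩ | ⟨rfl, -⟩)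
          · exact ⟨Or.inl rfl, hzS⟩
          · exact ⟨Or.inr (Or.inr (Or.inl rfl)), hlS⟩
      have hid := toReal_currentPairSum_clusterCompl_single_eq (G := G) (Λ := Λ) hθ hSΛ' hzS' (singleton_subset_iff.2 hk) hin
      rw [hout] at hid
      have hle : T S ≤ thetaCorr G Λ θ {k} * b S := by
        simp only [hT, hb]
        rw [hid]
        exact mul_le_mul_of_nonneg_right (thetaCorr_cplOff_le hθ _ (singleton_subset_iff.2 hk)) ENNReal.toReal_nonneg
      linarith [mul_nonneg hM_l (ha0 S)]
    · -- `k ∉ S`, `l ∈ S`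
      have hin : ({some z, some k, some l, none} : Finset (Option V)).filter (· ∈ S) = starSet {l} := by
        rw [starSet_singleton]
        ext v; simp only [mem_filter, mem_insert, mem_singleton, mem_symmDiff]
        constructor
        · rintro ⟨h | h | h | h, hv⟩
          · exact absurd (h ▸ hv) hzS
          · exact absurd (h ▸ hv) hkS
          · exact Or.inl ⟨h, fun h' => Option.some_ne_none l (h ▸ h')⟩
          · exact Or.inr ⟨h, fun h' => Option.some_ne_none l (h'.symm.trans h)⟩
        · rintro (⟨rfl, -⟩ | ⟨rfl, -⟩)
          · exact ⟨Or.inr (Or.inr (Or.inl rfl)), hlS⟩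
          · exact ⟨Or.inr (Or.inr (Or.inr rfl)), hnS⟩
      have hout : ({some z, some k, some l, none} : Finset (Option V)).filter (· ∉ S) = {some z} ∆ {some k} := by
        ext v; simp only [mem_filter, mem_insert, mem_singleton, mem_symmDiff]
        constructor
        · rintro ⟨h | h | h | h, hv⟩
          · exact Or.inl ⟨h, fun h' => hzk' (h.symm.trans h')⟩
          · exact Or.inr ⟨h, fun h' => hzk' (h'.symm.trans h)⟩
          · exact absurd (h ▸ hlS) hv
          · exact absurd (h ▸ hnS) hv
        · rintro (⟨rfl, -⟩ | ⟨rfl, -⟩)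
          · exact ⟨Or.inl rfl, hzS⟩
          · exact ⟨Or.inr (Or.inl rfl), hkS⟩
      have hid := toReal_currentPairSum_clusterCompl_single_eq (G := G) (Λ := Λ) hθ hSΛ' hzS' (singleton_subset_iff.2 hl) hin
      rw [hout] at hid
      have hle : T S ≤ thetaCorr G Λ θ {l} * a S := by
        simp only [hT, ha]
        rw [hid]
        exact mul_le_mul_of_nonneg_right (thetaCorr_cplOff_le hθ _ (singleton_subset_iff.2 hl)) ENNReal.toReal_nonneg
      linarith [mul_nonneg hM_k (hb0 S)]
    · -- both out: the sources outside are `{z,k,l}`, odd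
      have hodd : Odd #(({some z, some k, some l, none} : Finset (Option V)).filter (· ∉ S)) := by
        have : ({some z, some k, some l, none} : Finset (Option V)).filter (· ∉ S) = {some z, some k, some l} := by
          ext v; simp only [mem_filter, mem_insert, mem_singleton]
          constructor
          · rintro ⟨h | h | h | h, hv⟩
            · exact Or.inl h
            · exact Or.inr (Or.inl h)
            · exact Or.inr (Or.inr h)
            · exact absurd (h ▸ hnS) hv
          · rintro (rfl | rfl | rfl)
            · exact ⟨Or.inl rfl, hzS⟩
            · exact ⟨Or.inr (Or.inl rfl), hkS⟩
            · exact ⟨Or.inr (Or.inr (Or.inl rfl)), hlS⟩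
        rw [this, card_insert_of_notMem (by simp [hzk', hzl']), card_pair hkl'']
        decide
      have : T S = 0 := by
        simp only [hT]
        rw [show (fun m => ind (𝒮[m, some z] = S)) = (fun m : Eg → ℕ => ind (𝒮[m, some z] = S) * 1) from
          funext fun _ => (mul_one _).symm, currentPairSum_clusterCompl_eq_zero_of_odd θ hY hodd]
        simp
      rw [this]; exact hrest
  -- sum up
  rw [hexp, hexp, hexp]
  have hsum := sum_le_sum hterm
  rw [sum_add_distrib, ← mul_sum, ← mul_sum] at hsum
  have hZ2 : 0 < Z ^ 2 := pow_pos hZpos 2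
  calc (∑ S ∈ P', T S) / Z ^ 2 ≤ (thetaCorr G Λ θ {l} * ∑ S ∈ P', a S + thetaCorr G Λ θ {k} * ∑ S ∈ P', b S) / Z ^ 2 :=
        div_le_div_of_nonneg_right hsum hZ2.le
    _ = _ := by simp only [ha, hb]; ring

/-! ### The triple terms `Δ₂`: switching a pair out of the cluster of `x` -/

/-- **(5.1) for a single pair**, given that its first vertex lifts into `T`:
`∑_{({a}Δ{c})*,∅} w w 𝟙[𝒮_b = T] = ⟨σ_aσ_c⟩_{θ_T} W_b(T)`. [cite: AizenmanFernandezJSP1986, §5.1, Lemma 5.1, eq. (5.1), p. 425] -/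
theorem toReal_currentPairSum_pair_empty_clusterCompl_eq {θ : Sym2 (Option V) → ℝ} (hθ : ∀ e, 0 ≤ θ e)
    {T : Finset (Option V)} (hT : T ⊆ Λg) {b : Option V} (hb : b ∈ Λg \ T) {a c : V} (ha : a ∈ Λ) (hc : c ∈ Λ)
    (haT : (some a : Option V) ∈ T) :
    (currentPairSum G Λ θ ({some a} ∆ {some c}) ∅ (fun m => ind (𝒮[m, b] = T))).toReal =
      thetaCorr G Λ (cplOff θ (Eg \ edgesIn Gg T)) ({a} ∆ {c}) * (dctWb G Λ θ b T).toReal := by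
  have h := toReal_currentPairSum_pairs_clusterCompl_eq' (G := G) (Λ := Λ) hθ hT hb ha hc ha ha haT haT
  rw [show ({some a} ∆ {some a} : Finset (Option V)) = ∅ from symmDiff_self _,
    show ({a} ∆ {a} : Finset V) = ∅ from symmDiff_self _, thetaCorr_empty, mul_one] at h
  exact h

/-- **The bound on the triple terms** (Aizenman–Fernández 1986, (5.10)): for `θ ≥ 0` and
`x, u, v, k ∈ Λ`,
`∑_{(({x}Δ{u})Δ({v}Δ{k})),∅} w w 𝟙[x ↮ g] 𝟙[x ↔ u] 𝟙[x ↔ v] 𝟙[x ↔ k] ≤ ⟨σ_vσ_k⟩_{θ,h=0} ∑_{({x}Δ{u}),∅} w w 𝟙[x ↮ g]`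
("replace the restriction `x → z` by the weaker `z ↮ h`", switch the pair `{v,k}` into the second
current, condition on `C(h)` (5.1), pull out `⟨σ_vσ_k⟩_{C^c(h)} ≤ ⟨σ_vσ_k⟩_{h=0}`, and resum with
(5.3)). [cite: AizenmanFernandezJSP1986, §5.1, proof of Prop. 5.2, eq. (5.10), p. 427] -/
theorem currentPairSum_four_conn_le {θ : Sym2 (Option V) → ℝ} (hθ : ∀ e, 0 ≤ θ e) {x u v k : V} (hx : x ∈ Λ)
    (hu : u ∈ Λ) (hv : v ∈ Λ) (hk : k ∈ Λ) :
    (currentPairSum G Λ θ (({some x} ∆ {some u}) ∆ ({some v} ∆ {some k})) ∅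
        (fun m => ind (¬Conn[m, some x, none]) *
          (ind (Conn[m, some x, some u]) * ind (Conn[m, some x, some v]) * ind (Conn[m, some x, some k])))).toReal ≤
      thetaCorr G Λ (zeroField θ) ({v} ∆ {k}) *
        (currentPairSum G Λ θ ({some x} ∆ {some u}) ∅ (fun m => ind (¬Conn[m, some x, none]))).toReal := by
  classical
  -- Step 1: weaken the event
  have hmono : currentPairSum G Λ θ (({some x} ∆ {some u}) ∆ ({some v} ∆ {some k})) ∅
      (fun m => ind (¬Conn[m, some x, none]) *
        (ind (Conn[m, some x, some u]) * ind (Conn[m, some x, some v]) * ind (Conn[m, some x, some k]))) ≤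
      currentPairSum G Λ θ (({some x} ∆ {some u}) ∆ ({some v} ∆ {some k})) ∅
        (fun m => (ind (¬Conn[m, some x, none]) * ind (¬Conn[m, some v, none])) * ind (Conn[m, some v, some k])) := by
    refine currentPairSum_mono fun n₁ n₂ _ _ => ?_
    by_cases hxv : Conn[n₁ + n₂, some x, some v]
    · by_cases hxk : Conn[n₁ + n₂, some x, some k]
      · by_cases hxg : Conn[n₁ + n₂, some x, none]
        · rw [ind_of_false (not_not.2 hxg), zero_mul]; exact bot_le
        · have hvg : ¬Conn[n₁ + n₂, some v, none] := fun h => hxg (hxv.trans h)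
          have hvk : Conn[n₁ + n₂, some v, some k] := hxv.symm.trans hxk
          rw [ind_of_true hxg, ind_of_true hvg, ind_of_true hvk]
          calc (1 : ℝ≥0∞) * (ind (Conn[n₁ + n₂, some x, some u]) * ind (Conn[n₁ + n₂, some x, some v]) *
                ind (Conn[n₁ + n₂, some x, some k]))
              ≤ 1 * (1 * 1 * 1) := by gcongr <;> exact ind_le_one _
            _ = 1 * 1 * 1 := by ring
      · rw [ind_of_false hxk, mul_zero, mul_zero]; exact bot_le
    · rw [ind_of_false hxv, mul_zero, zero_mul, mul_zero]; exact bot_le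
  -- Step 2: switch `{v,k}` into the second current
  have hsw := currentPairSum_switching (G := G) (Λ := Λ) hθ (({some x} ∆ {some u}) ∆ ({some v} ∆ {some k}))
    (some v) (some k) (fun m => ind (¬Conn[m, some x, none]) * ind (¬Conn[m, some v, none]))
  rw [symmDiff_symmDiff_cancel_right] at hsw
  -- Step 3: decompose over the cluster of the ghost with `x, v ∉ C(g)`
  set P := Λ.powerset.filter (fun S' => x ∈ S' ∧ v ∈ S') with hP
  have hdec : currentPairSum G Λ θ ({some x} ∆ {some u}) ({some v} ∆ {some k})
      (fun m => ind (¬Conn[m, some x, none]) * ind (¬Conn[m, some v, none])) =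
      ∑ S' ∈ P, currentPairSum G Λ θ ({some x} ∆ {some u}) ({some v} ∆ {some k})
        (fun m => ind (𝒮[m, none] = S'.map Function.Embedding.some)) := by
    rw [← currentPairSum_finset_sum]
    refine currentPairSum_congr fun n₁ n₂ _ _ => ?_
    rw [sum_ind_clusterCompl_none, mem_eraseNone_clusterCompl_none_iff hx, mem_eraseNone_clusterCompl_none_iff hv, ind_and]
  have hdec1 : currentPairSum G Λ θ ({some x} ∆ {some u}) ∅ (fun m => ind (¬Conn[m, some x, none])) =
      ∑ S' ∈ Λ.powerset.filter (fun S' => x ∈ S'), currentPairSum G Λ θ ({some x} ∆ {some u}) ∅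
        (fun m => ind (𝒮[m, none] = S'.map Function.Embedding.some)) := by
    rw [← currentPairSum_finset_sum]
    refine currentPairSum_congr fun n₁ n₂ _ _ => ?_
    rw [sum_ind_clusterCompl_none, mem_eraseNone_clusterCompl_none_iff hx]
  -- Step 4: termwise (5.1) and the link bound
  have hL0 : 0 ≤ thetaCorr G Λ (zeroField θ) ({v} ∆ {k}) :=
    thetaCorr_nonneg (zeroField_nonneg hθ) (symmDiff_le_sup.trans (sup_le (singleton_subset_iff.2 hv) (singleton_subset_iff.2 hk)))
  have hterm : ∀ S' ∈ P, (currentPairSum G Λ θ ({some x} ∆ {some u}) ({some v} ∆ {some k})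
      (fun m => ind (𝒮[m, none] = S'.map Function.Embedding.some))).toReal ≤
      thetaCorr G Λ (zeroField θ) ({v} ∆ {k}) *
        (currentPairSum G Λ θ ({some x} ∆ {some u}) ∅ (fun m => ind (𝒮[m, none] = S'.map Function.Embedding.some))).toReal := by
    intro S' hS'
    obtain ⟨hS'Λ, hxS', hvS'⟩ := mem_filter.1 hS'
    have hSΛ : S'.map Function.Embedding.some ⊆ Λg := fun w hw => by
      obtain ⟨t, ht, rfl⟩ := mem_map.1 hw
      exact Finset.some_mem_insertNone.2 (mem_powerset.1 hS'Λ ht)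
    have hb : (none : Option V) ∈ Λg \ S'.map Function.Embedding.some :=
      mem_sdiff.2 ⟨Finset.mem_insertNone.2 (by simp), fun h => by
        obtain ⟨t, -, ht⟩ := mem_map.1 h; exact Option.some_ne_none t ht⟩
    have hn : (none : Option V) ∉ S'.map Function.Embedding.some := (mem_sdiff.1 hb).2
    rw [toReal_currentPairSum_pairs_clusterCompl_eq' hθ hSΛ hb hx hu hv hk (mem_map_of_mem _ hxS') (mem_map_of_mem _ hvS'),
      toReal_currentPairSum_pair_empty_clusterCompl_eq hθ hSΛ hb hx hu (mem_map_of_mem _ hxS')]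
    have hG0 : 0 ≤ thetaCorr G Λ (cplOff θ (Eg \ edgesIn Gg (S'.map Function.Embedding.some))) ({x} ∆ {u}) :=
      thetaCorr_cplOff_pair_nonneg hθ _ hx hu
    have hlink := thetaCorr_cplOff_le_zeroField (G := G) (Λ := Λ) hθ hn
      (symmDiff_le_sup.trans (sup_le (singleton_subset_iff.2 hv) (singleton_subset_iff.2 hk)) : ({v} ∆ {k} : Finset V) ⊆ Λ)
    have hW0 : 0 ≤ (dctWb G Λ θ none (S'.map Function.Embedding.some)).toReal := ENNReal.toReal_nonneg
    calc thetaCorr G Λ (cplOff θ (Eg \ edgesIn Gg (S'.map Function.Embedding.some))) ({x} ∆ {u}) *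
          thetaCorr G Λ (cplOff θ (Eg \ edgesIn Gg (S'.map Function.Embedding.some))) ({v} ∆ {k}) *
          (dctWb G Λ θ none (S'.map Function.Embedding.some)).toReal
        ≤ thetaCorr G Λ (cplOff θ (Eg \ edgesIn Gg (S'.map Function.Embedding.some))) ({x} ∆ {u}) *
          thetaCorr G Λ (zeroField θ) ({v} ∆ {k}) * (dctWb G Λ θ none (S'.map Function.Embedding.some)).toReal :=
          mul_le_mul_of_nonneg_right (mul_le_mul_of_nonneg_left hlink hG0) hW0
      _ = _ := by ring
  -- Step 5: assemble
  have hfin : ∀ (X' Y' : Finset (Option V)) (S' : Finset V),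
      currentPairSum G Λ θ X' Y' (fun m => ind (𝒮[m, none] = S'.map Function.Embedding.some)) ≠ ∞ :=
    fun X' Y' S' => currentPairSum_ne_top hθ _ _ fun _ => ind_le_one _
  calc (currentPairSum G Λ θ (({some x} ∆ {some u}) ∆ ({some v} ∆ {some k})) ∅
        (fun m => ind (¬Conn[m, some x, none]) *
          (ind (Conn[m, some x, some u]) * ind (Conn[m, some x, some v]) * ind (Conn[m, some x, some k])))).toReal
      ≤ (currentPairSum G Λ θ ({some x} ∆ {some u}) ({some v} ∆ {some k})
          (fun m => ind (¬Conn[m, some x, none]) * ind (¬Conn[m, some v, none]))).toReal := by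
        rw [hsw]
        exact ENNReal.toReal_mono (currentPairSum_ne_top hθ _ _ fun _ =>
          le_trans (mul_le_mul' (mul_le_mul' (ind_le_one _) (ind_le_one _)) (ind_le_one _)) (by simp)) hmono
    _ = ∑ S' ∈ P, (currentPairSum G Λ θ ({some x} ∆ {some u}) ({some v} ∆ {some k})
          (fun m => ind (𝒮[m, none] = S'.map Function.Embedding.some))).toReal := by
        rw [hdec, ENNReal.toReal_sum (fun S' _ => hfin _ _ S')]
    _ ≤ ∑ S' ∈ P, thetaCorr G Λ (zeroField θ) ({v} ∆ {k}) *
          (currentPairSum G Λ θ ({some x} ∆ {some u}) ∅ (fun m => ind (𝒮[m, none] = S'.map Function.Embedding.some))).toReal :=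
        sum_le_sum hterm
    _ ≤ ∑ S' ∈ Λ.powerset.filter (fun S' => x ∈ S'), thetaCorr G Λ (zeroField θ) ({v} ∆ {k}) *
          (currentPairSum G Λ θ ({some x} ∆ {some u}) ∅ (fun m => ind (𝒮[m, none] = S'.map Function.Embedding.some))).toReal := by
        refine sum_le_sum_of_subset_of_nonneg (fun S' hS' => ?_) (fun S' _ _ => mul_nonneg hL0 ENNReal.toReal_nonneg)
        obtain ⟨h1, h2, -⟩ := mem_filter.1 hS'
        exact mem_filter.2 ⟨h1, h2⟩
    _ = _ := by
        rw [← mul_sum, hdec1, ENNReal.toReal_sum (fun S' _ => hfin _ _ S')]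

end SingleSpin

end Literature.Probability.LatticeModels
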